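import Mathlib
import HarnessLib
import HarnessLib.Audit
import Summits.Parity.Statement
import HarnessLib.Audit.Status.Attr

/-!
Route: LambertRoots

DORMANT since 2026-08-24T05:39:44Z (reconciler: no traction for 6.6 d (last activity statement-attached at 2026-08-17T15:14:04Z); parked, not closed — `ledger route dormant route-Parity-LambertRoots --off` to reactivate) — unstaffed, not closed; items shared with open routes are served there. `ledger route dormant <id> --off` reactivates.

# Route LambertRoots — smooth before you open — Bateman–Horn as a Lambert series over root classes;
the window is DFI-grade, the Tauberian step is free

RESCUED LINE (lens rescuer): Golomb's Λ-method for Bateman–Horn (Golomb1970;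
Conrad2003HardyLittlewoodConstants; HindryRivoal2005Golomb
eq. (14); Pontes2012GolombBatemanHorn) writes, for z = e^(−1/x), Σ_n ∏Λ(f_i(n)) zⁿ = (−1)^k Σ_d
∏μ(d_i)log d_i · Σ_(ν root class mod L=lcm d) z^ν/(1−z^L)
EXACTLY (geometric series over root classes) and dies at ONE step, the termwise limit z→1 under Σ_d
(HR (16)–(17); "elusive for nonlinear
polynomials"; Pontes Thm 7.3: the summability method is not regular, so no soft Abelian theorem does
it). Do NOT interchange: cut the
d-sum at lcm ≍ x·polylog. Below, the geometric series is its pole plus a first-moment root statistic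
(trivial); in the window
x/(log x)^A < lcm ≤ x(log x)^A the kernel h_T(a) = T e^(−aT)/(1−e^(−T)) (T = lcm/x) has ∫₀¹h_T = 1
EXACTLY, so the deviation from the
termwise limit is a mean-zero smooth statistic of the roots ν/L twisted by ∏μ(d_i)log d_i — crux
MuRootWeyl (r4; Duke–Friedlander–Iwaniec /
Tóth grade in degree 2); above it only the parity tail survives, filed as NearWindow (r3: x(log x)^A
< lcm ≤ x^(1+η), smooth μ-signed small-root
statistic just beyond x) and DeepTail (r2: lcm > x^(1+η), Möbius of the large cofactor along root
classes below x^(1−η) — the atom). Because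
∏Λ(f_i(n)) ≥ 0, the Hardy–Littlewood–Karamata Tauberian theorem (tree, PROVED) un-smooths for free.
It suffices to show X = DeepTail ∧
NearWindow ∧ MuRootWeyl; supports SingularSeriesLcm, LambertFrame, TauberStep, LambdaToCount
(stmt-Parity-0874, proved) are theorem-grade.
Lean: `(∀ (k : ℕ) (f : Fin k → Polynomial ℤ), Literature.NumberTheory.Sieve.IsBatemanHornSystem f →
∀ η : ℝ, 0 < η → (fun x : ℕ => ∑ n ∈ Finset.Icc 1 (x ^ 2), Real.exp (-((n : ℝ) / x)) * ∑ d ∈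
Fintype.piFinset (fun i => (((f i).eval (n : ℤ)).toNat).divisors), if (x : ℝ) ^ (1 + η) <
((Finset.univ.lcm d : ℕ) : ℝ) then ∏ i, ((ArithmeticFunction.moebius (d i) : ℝ) * Real.log (d i))
else 0) =o[Filter.atTop] fun x : ℕ => (x : ℝ)) ∧ (∀ (k : ℕ) (f : Fin k → Polynomial ℤ),
Literature.NumberTheory.Sieve.IsBatemanHornSystem f → ∃ A η : ℝ, 0 < A ∧ 0 < η ∧ (fun x : ℕ => ∑ n ∈
Finset.Icc 1 (x ^ 2), Real.exp (-((n : ℝ) / x)) * ∑ d ∈ Fintype.piFinset (fun i => (((f i).eval (n :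
ℤ)).toNat).divisors), if (x : ℝ) * Real.log x ^ A < ((Finset.univ.lcm d : ℕ) : ℝ) ∧
((Finset.univ.lcm d : ℕ) : ℝ) ≤ (x : ℝ) ^ (1 + η) then ∏ i, ((ArithmeticFunction.moebius (d i) : ℝ)
* Real.log (d i)) else 0) =o[Filter.atTop] fun x : ℕ => (x : ℝ)) ∧ (∀ (k : ℕ) (f : Fin k →
Polynomial ℤ), Literature.NumberTheory.Sieve.IsBatemanHornSystem f → ∀ A B : ℝ, 0 < A → 0 < B → ∃ C
: ℝ, ∃ D₀ : ℕ, ∀ D : ℕ, D₀ ≤ D → ∀ j : ℤ, j ≠ 0 → (|j| : ℝ) ≤ Real.log D ^ B → ‖∑ d ∈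
(Fintype.piFinset fun _ : Fin k => Finset.Icc 1 D).filter (fun d => Finset.univ.lcm d ≤ D), ((∏ i,
((ArithmeticFunction.moebius (d i) : ℝ) * Real.log (d i)) : ℝ) : ℂ) * ∑ ν ∈ (Finset.range
(Finset.univ.lcm d)).filter (fun ν : ℕ => ∀ i, ((d i : ℕ) : ℤ) ∣ (f i).eval (ν : ℤ)), Complex.exp (2
* Real.pi * Complex.I * ((j : ℂ) * (ν : ℂ) / ((Finset.univ.lcm d : ℕ) : ℂ)))‖ ≤ C * (D : ℝ) /
Real.log D ^ A)`

## Assembly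
Pure logic, sorry-free in Sketch.lean / glue.lean (`closes`): fix k, f, IsBatemanHornSystem f;
SingularSeriesLcm gives C > 0, HasBatemanHornConst f C
and the lcm-ordered log-weighted singular series → (−1)^k C; LambertFrame fed with DeepTail_f,
NearWindow_f, MuRootWeyl_f and that series gives
the smoothed Λ-asymptotic Σ_(n≤x²) e^(−n/x)∏Λ(f_i(n)) ~ C x; TauberStep (positivity +
Hardy–Littlewood–Karamata) gives Σ_(n≤x)∏Λ(f_i(n)) ~ C x;
LambdaToCount (proved) gives BatemanHornAsymptotic f; BatemanHorn = ∀ k f, IsBatemanHornSystem f →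
BatemanHornAsymptotic f.

Rationale: WHY THIS LINE. Two corpses, one dodge each. (1) Literature: Golomb 1956/1970 → Conrad 2003
(Dirichlet series, Thm 7: Σ_d μ(d)log^k d N_f(d)/d = c(f)) →
Hindry–Rivoal 2005 (power series (14), reduction of BH to the termwise limit (17)) → Pontes 2012
(Thm 7.3: non-regular, soft theorems void) →
Xiao 2025 (doi:10.20944/preprints202512.2666.v1, unrefereed, 286 pp., claims the interchange via the
monotone convergence theorem, Lemma 9 —
unverified here, and Bateman–Horn is registered open): killed by the interchange; dodge = quantify
it in three lcm-ranges against x, where it FAILS only in the window (curable: μ-twisted root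
equidistribution,
DukeFriedlanderIwaniec1995 / Toth2000 / DukeFriedlanderIwaniec1997 technology) and in the tail (the
honest parity cruxes). (2) Ours: route
TauberianTwins (GHL, retired not-a-thesis, not re-filed) needed an HL-complete Tauberian crux
(ScaleRigidity/Ikehara) because a Dirichlet
series + Karamata give only log density (Literature.Barriers.Parity.LogarithmicAveraging); dodge =
the POWER series: positivity of ∏Λ makes the
Tauberian step the tree theorem
Literature.NumberTheory.LFunctions.HardyLittlewoodTauberianSums_holds, and on BatemanHorn the
per-system
statement lets `closes` reach the Statement. What it does that the open X_PM routes
(PolynomialMobius + GaussianFractions / CyclotomicTower /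
CrossedSalie / IsogenyRedei slices) do not: they open Λ = −Σμ log UNDER the sharp cutoff n ≤ x, so
every progression has a boundary
(sawtooth ψ((x−ν)/d), archimedean phases e(hx/d)) and the moduli (x^(1−η), x·polylog] become hard
window cruxes (RootLevelBeyondHalf,
RootFractionsBound, QuarticPrimeWindow); smoothing FIRST (free by positivity) and opening SECOND
removes that window into MuRootWeyl with
frequencies |j| ≤ (log D)^B only. Imported areas: Tauberian theory (Karamata), equidistribution of
roots of congruences (DFI/Tóth/Hooley,
Kowalski–Soundararajan), classical Lambert-series bookkeeping; no spectral/probabilistic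
reformulation.

RANKED CRUXES. #2 DeepTail (crux) — for every Bateman–Horn system f and every η > 0: Σ_(n ≤ x²)
e^(−n/x) Σ_(d_i ∣ f_i(n), lcm(d) > x^(1+η)) ∏_i μ(d_i) log d_i = o(x). k = 1, deg g: lcm = d >
x^(1+η) iff the cofactor e = f(n)/d < f(n)/x^(1+η) ≈ x^(g−1−η): Möbius randomness of the large
cofactor along the root classes of f mod e at level power-below x^(g−1) — the parity atom of the
line (for n²+1: e ≤ x^(1−η); contains Σ e^(−n/x) μ(f(n)) log f(n) = o(x)). [difficulty:
open-problem] (why it might fail: Parity-hard: contains the smooth log-weighted polynomial Möbius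
atom (open in every degree ≥ 2, cf. stmt-Parity-0871/0872) and, for deg ≥ 3, balanced factorisations
d,e > x with no Type-I/II structure (FordMaynard2024PrimeSieves §2.4 thin sets).)
[HindryRivoal2005Golomb, BombieriAsymptoticSieve1976, FordMaynard2024PrimeSieves, Chowla1965,
arXiv:2008.09905]
#3 NearWindow (crux) — for every Bateman–Horn system f there are A, η > 0 with Σ_(n ≤ x²) e^(−n/x)
Σ_(d_i ∣ f_i(n), x(log x)^A < lcm(d) ≤ x^(1+η)) ∏_i μ(d_i) log d_i = o(x). After exchanging sums: Σ
over tuples with lcm L ∈ (x(log x)^A, x^(1+η)] of ∏μ(d_i)log d_i · Σ_(ν root class mod L) e^(−ν/x) —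
a ∏μ·log-signed SMOOTH small-root statistic (kernel e^(−(ν/L)(L/x)), relative scale x/L ≥ x^(−η))
over moduli just beyond x; no archimedean phase, no marked primes. [deps: MuRootWeyl] [difficulty:
L] (why it might fail: Needs μ-twisted root Weyl sums with power-uniformity in |j| ≤ (L/x)·polylog ≤
x^η: DFI/Tóth bounds are polynomial in the frequency, fine only for η < δ/c; for deg ≥ 3 even
prime-moduli equidistribution with a rate is open (KowalskiSoundararajan2021 Conj. A.2).)
[DukeFriedlanderIwaniec1995, Toth2000, KowalskiSoundararajan2021, DukeFriedlanderIwaniec1997,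
Hooley1964]
#4 MuRootWeyl (crux) — for every Bateman–Horn system f and all A, B > 0 there are C, D₀ such that
for D ≥ D₀ and 0 < |j| ≤ (log D)^B: |Σ_(tuples d ∈ [1,D]^k, L = lcm(d) ≤ D) ∏_i μ(d_i) log d_i ·
Σ_(0 ≤ ν < L, d_i ∣ f_i(ν) ∀i) e(jν/L)| ≤ C·D/(log D)^A. (∏μ·log-twisted Weyl sums of the joint
roots, log-power saving, log-power frequency range; for k = 1 the inner sum is
Literature.NumberTheory.Sieve.polyRootWeylSum (f 0) L j. It does NOT assert equidistribution — false
for linear f_i — only Möbius cancellation in the modulus.) [difficulty: L] (why it might fail: In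
print only the Λ-weighted prime-moduli sums for ONE quadratic (DFI 1995 negative, Tóth 2000 positive
discriminant) and Hooley's untwisted (log D)^(−δ) for deg ≥ 3; k ≥ 2 needs μ⊗μ against
Kloosterman-fraction CRT phases (DFI 1997 bilinear ranges + Siegel–Walfisz) — unproved as stated.)
[DukeFriedlanderIwaniec1995, Toth2000, Hooley1964, DukeFriedlanderIwaniec1997,
KowalskiSoundararajan2021]
#9 SingularSeriesLcm (support) — for every Bateman–Horn system f there is C > 0 with
HasBatemanHornConst f C and Σ_(tuples d, lcm(d) ≤ y) ∏μ(d_i)log d_i · ρ_f(d)/lcm(d) → (−1)^k C as y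
→ ∞ (ρ_f(d) = number of joint root classes mod lcm). The Dirichlet/power-series singular series of
Golomb–Conrad (Conrad2003HardyLittlewoodConstants Thm 7, product-polynomial form; Pontes Ch. 6 S(f)
= C(f)); sibling of PolynomialMobius.TypeIMainTerm (stmt-Parity-0873) without the counting. Prime
ideal theorem with error in the splitting fields; theorem-grade, L. [difficulty: L]
[Conrad2003HardyLittlewoodConstants, BatemanHornMathComp1962, Pontes2012GolombBatemanHorn]
#9 LambertFrame (support) — THE FRAME (theorem-grade analysis, no arithmetic conjecture inside): for
a Bateman–Horn system f and C with HasBatemanHornConst f C, the singular series (lcm-ordered, limit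
(−1)^k C) + DeepTail_f + NearWindow_f + MuRootWeyl_f imply Σ_(n ≤ x²) e^(−n/x) ∏Λ(f_i(n)) / x → C.
Proof plan: ∏Λ = (−1)^k Σ ∏μ log (Mathlib ArithmeticFunction.sum_moebius_mul_log_eq); exchange
finite sums; each joint root class ν mod L sums to Σ_m e^(−(ν+mL)/x) = geometric series =
(x/L)·h_(L/x)(ν/L) + O(1), h_T(a) = Te^(−aT)/(1−e^(−T)), ∫₀¹h_T = 1; lcm ≤ x/(log x)^A: pole + first
Bernoulli moment, trivially O(x(log x)^(c−A)); window: Fourier-truncate h_T − 1 at |j| ≤ (log x)^B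
(coefficients T/(T+2πij)), near-zero roots counted by Σ_(n ≤ y) ∏τ(f_i(n)) ≪ y(log y)^c, then
MuRootWeyl by partial summation; lcm > x(log x)^A: m ≥ 1 terms ≤ e^(−(log x)^A), m = 0 terms =
NearWindow + DeepTail; main term x·S(x(log x)^A) → (−1)^k·(−1)^k C x. [difficulty: L]
[HindryRivoal2005Golomb, Golomb1970, MontgomeryVaughan2007, Hooley1964]
#9 TauberStep (support) — positivity un-smooths: for a Bateman–Horn system f and C > 0, Σ_(n ≤ x²)
e^(−n/x) ∏Λ(f_i(n)) / x → C (x : ℕ → ∞) implies Σ_(n ≤ x) ∏Λ(f_i(n)) ~ C x. Monotone interpolation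
in the smoothing parameter (integer x suffices since t ↦ Σ a_n e^(−nt) is monotone), truncation n >
x² negligible (∏Λ(f_i(n)) ≤ ∏ log f_i(n)), then the tree theorem
Literature.NumberTheory.LFunctions.HardyLittlewoodTauberianSums_holds (MV Thm 5.7, λ_n = n, β = 1,
c_n = a_n − C, w_n = C). Provable now, M. [difficulty: provable-now] [MontgomeryVaughan2007,
HindryRivoal2005Golomb]
#9 LambdaToCount (support) — shared VERBATIM with PolynomialMobius (stmt-Parity-0874, closed proved
by Summit.Parity.BatemanHorn.LambdaToCount.lambdaToCount_proof): Σ_(n ≤ x) ∏Λ(f_i(n)) ~ C x with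
HasBatemanHornConst f C gives BatemanHornAsymptotic f. [difficulty: provable-now]
[BatemanHornMathComp1962]

TWO-LAYER PLAN. Foreseen glued splits once a crux moves: MuRootWeyl ⇐ MuRootWeylLinear (k=1: Vaughan
+ Type I along multiples + Type II bilinear for ρ_j(mn),
DFI/Tóth in degree 2) → MuRootWeylCRT (k ≥ 2: reciprocity to Kloosterman fractions, DFI 1997 +
Siegel–Walfisz in the unbalanced ranges) → MuRootWeyl;
DeepTail ⇐ DeepTailDegTwo (k = 1, deg 2: cofactor Möbius along root classes at level x^(1−η), the
GaussianFractions TypeII/atom regime) →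
DeepTailRest → DeepTail; NearWindow ⇐ power-uniform MuRootWeyl (|j| ≤ D^ε) → NearWindow (then
NearWindow merges into r4 for quadratics).

KILL CRITERIA. MuRootWeyl refuted (a ∏μ·log-twisted root Weyl sum without log-power cancellation,
e.g. μ correlating with a root statistic in some degree ≥ 3
family) ⇒ the window is NOT curable by equidistribution: close `refuted:MuRootWeyl` unless the
witness is a misstatement (frequency range /
gcd(j, L) bookkeeping), then restate. DeepTail or NearWindow refuted for a system where MuRootWeyl
and the supports hold ⇒ by LambertFrame +
the Abelian direction this REFUTES the Λ-form of Bateman–Horn for that system: file ¬BatemanHorn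
with the witness. SingularSeriesLcm /
LambertFrame / TauberStep refuted ⇒ my bookkeeping (sign (−1)^k, lcm vs product, truncation x²,
kernel normalisation) is wrong ⇒ re-derive and
restate, do not close. PolyMobiusTail (stmt-Parity-0870) proved elsewhere moots the route (BH
follows by PolynomialMobius.closes).

NOT DECOMPOSED YET. Two wrinkles of LambertFrame's proof (theorem-grade, deliberately not items):
(a) systems with a member vanishing at a positive integer or at 0
(only f_i = X or a linear aX+b with a ∣ b): the progressions of the finitely many joint root classes
ν < n₀ start at m ≥ 1, and the dropped first
terms / the endpoint value h_T(1) vs h_T(0) for ν ≡ 0 cost Σ_(L≤y) μ(L) log L ≪ y/(log y)^A' — the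
prime number theorem for μ with log-power error
(tree: classical zero-free region), not MuRootWeyl (which has j ≠ 0); (b) tuples sharing a prime p
between two coordinates force a common root of
f_i, f_i' mod p, so p ∣ Res(f_i, f_i') — finitely many — whence lcm = ∏d_i off a finite set of
primes and the weights ∏μ(d_i)log d_i genuinely
oscillate (no positive diagonal). The degree-2 / k = 1 slice of MuRootWeyl as Literature facts (DFI
1995 Props 1–2, Tóth's linear/bilinear forms already vendored:
Literature.NumberTheory.Sieve.toth2000_weylLinearForm / toth2000_bilinearForm) — a layer-2 child;
the divisor-sum bound Σ_(n≤y)∏τ(f_i(n)) ≪ y(log y)^c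
(Landreau / Nair–Tenenbaum) inside LambertFrame; the choice of smoothing kernel (t^a e^(−t), a ≥ 2,
makes the window Fourier series absolutely
convergent; Mellin transform Γ(s+a) keeps the Tauberian step); uniformity in f (none is claimed);
the deg ≥ 3 balanced regime inside DeepTail.

CHEAPEST FALSIFIER. (i) Lookup: does DFI 1995 / Tóth 2000 give a RATE (log-power or power saving,
polynomial in the frequency h) for Σ_(p≤x) ρ_h(p) log p and the
Type-I/II inputs with μ in place of Λ? If only o(π(x)) with no rate and no h-uniformity is
extractable, MuRootWeyl in degree 2 is not "in print
modulo porting" and r4 rises to rank 2. (ii) In-tree sanity (done): Sketch.lean / SketchOneLine.lean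
elaborate (lean check rc 0, 0 sorry), closes
certified shape; k = 0 and linear f = X + h instances of all items checked by hand (ν/L → 1: no
equidistribution, MuRootWeyl still true by PNT;
SingularSeriesLcm sign (−1)^k C checked on f = X: Σ μ(d) log d/d = −1). (iii) Numerics (not run, kit
not in payload): for f = X²+1, x = 10⁶,
the three pieces of (1−z)G_f(z) − 𝔖·x at A = 2: window piece should already be ≤ 0.05x if
MuRootWeyl-type cancellation is real.

NUMBERS. Tree facts used: Literature.NumberTheory.LFunctions.HardyLittlewoodTauberianSums_holds (MV
2007 Thm 5.7, PROVED); stmt-Parity-0874 LambdaToCount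
(PROVED); Literature.NumberTheory.Sieve.IsBatemanHornSystem.hasBatemanHornConst_holds (ordered Euler
product, PROVED);
Literature.NumberTheory.Sieve.dukeFriedlanderIwaniec1995_quadraticRoots_primeModuli,
toth2000_quadraticRoots_primeModuli (named facts, o(π(x)) form),
toth2000_weylLinearForm (power saving (d/M)^(1/4L) M^(1+1/L²)), toth2000_bilinearForm (M^(1/2) + N^a
M^b). Hindry–Rivoal (14)/(16)/(17) and
Conrad Thm 7 as printed in Xiao 2025 pp. 4–5; Pontes 2012 pp. 7, 67–69 (Thm 7.3). Items at open: 8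
(3 cruxes, 4 supports, 1 assembly).

DEFINITION REQUESTS. None. (Joint root classes of a system modulo lcm(d) are inlined; for k = 1 they
coincide with the root set of Literature.NumberTheory.Sieve.polyRootWeylSum.)

Novelty: Searches (2026-08-16): `lit search "Golomb lambda method" --source zbmath` (8; Golomb1970,
HindryRivoal zbl:1180.11032); `lit search "Hindry Rivoal
Golomb Bateman-Horn" --source zbmath --reviews` (1); `lit search "… Lambda-calcul de Golomb …"
--source crossref` (4: Pontes 2012 thesis doi:10.11606/…,
Xiao 2025 doi:10.20944/preprints202512.2666.v1 and 202505.0651.v1, Lang 1996); `lit read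
doi:10.11606/d.45.2012.tde-25072012-204437` (held, pp. 5,7,16,17,77–79
read); `lit read 10.20944/preprints202512.2666.v1` (pp. 33–34 read: HR (14),(16),(17), Conrad Thm
7); `lit search --hybrid` ×3 (Tauberian/BH; no hit beyond
textbooks MV2007, Cojocaru–Murty); `lit galaxy search "Bateman-Horn Tauberian" | "power series
Bateman-Horn Golomb" | "calcul de Golomb" --star all` (0/0/1
irrelevant); `lit search "Conrad Hardy-Littlewood constants" --source zbmath` (zbl:1054.11050); `lit
frontier Parity --since 2022` (30 rows; arXiv:2605.01155
Banks–Ford-type BH statistics, nothing Tauberian); `lean search Tauberian|Karamata` (tree: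
HardyLittlewoodTauberianSums_holds); tree greps of all BH/GHL
Theses and 140 BH cards for tauber/power series/smooth/Lambert/Golomb/Hindry (hits: TauberianTwins
(GHL, retired), landau-parity-corner (cites Golomb1970 as
prior art for a J_z-corner idea), crux idea natural-form-affine-hooley-window (sharp log cut-off +
affine Hooley sums for the window)).
Nearest prior art found: HindryRivoal2005Golomb (eq. (14): the same Lambert series; BH ⟺ termwise
limit (17), left open) wi  [refs: 10.11606/…, 10.20944/preprints202512.2666.v1, 10.11606/d.45.2012.tde-25072012-204437`, 10.20944/preprints202512.2666.v1`, 2605.01155, doi:10.11606/, doi:10.20944/preprints202512.2666.v1, doi:10.11606/d.45.2012.tde-25072012-204437, Golomb1970]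

Barriers (technique_class: tauberian-smoothing lambert-series moebius-tail root-weyl): - technique_class: tauberian-smoothing lambert-series moebius-tail root-weyl
- Literature.Barriers.Parity.SelbergParityBarrier: not evaded and not engaged by the frame: all
parity content is relocated, μ-signed, into DeepTail (+ NearWindow); Type-I data enter only through
the EXACT geometric series, never as a lower-bound sieve; the bet is that the atom "cofactor Möbius
along root classes below x^(1−η)" is the right and smallest thing to isolate.
- Literature.Barriers.Parity.FordMaynardLowLevel: applies to any Type-I/II attack on DeepTail for
deg ≥ 3 (thin set, no Type-II range); the route asks for DeepTail as input outside (I)/(II) — honest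
form: it does not evade, it names what is missing; MuRootWeyl/NearWindow are statements about roots
of congruences (modulus-side harmonic analysis), outside the (I)/(II) data of the sequence.
- Literature.Barriers.Parity.FordMaynardMinimalTypeII: same as above; no claim that Type-I
information alone forces primes.
- Literature.Barriers.Parity.LogarithmicAveraging: EVADED by construction — no logarithmic average
anywhere: the Abel/power-series mean Σ a_n e^(−n/x)/x with a_n = ∏Λ(f_i(n)) ≥ 0 transfers to the
Cesàro mean by the Hardy–Littlewood–Karamata theorem (tree: HardyLittlewoodTauberianSums_holds);
Hall's set defeats log→Cesàro transfer, not Abel→Cesàro for non-negative sequences.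
- Literature.Barriers.Parity.CircleMethodBinaryBarrier: not engaged (no minor arcs in n; the only
harmonic analysis is on ν/L at conductor ≤ polylog).
- Lite

History (route lifecycle, newest last):
- 2026-08-16T16:36:57Z · rev 2: dropped LambertFrame — repair glue.non-crux-hypothesis: crux-only closes (DeepTail, NearWindow, MuRootWeyl, FrameToBH); LambertFrame (stmt-Parity-16281) superseded by FrameToBH (stmt- (planner-plan-lens-Parity-rescuer-v2-g2-0)
- 2026-08-16T16:38:06Z · rev 3: restated Assembly (stmt-Parity-16284) — restate Assembly after LambertFrame was dropped (rev 2): same chain as closes (planner-plan-lens-Parity-rescuer-v2-g2-0)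
- 2026-08-24T05:39:44Z · DORMANT — reconciler: no traction for 6.6 d (last activity statement-attached at 2026-08-17T15:14:04Z); parked, not closed — `ledger route dormant route-Parity-LambertRoo (operator:999:3405232)

sub-problem: BatemanHorn · status: dormant · opened planner-plan-lens-Parity-rescuer-v2-g2-0 2026-08-16T16:30:46Z · rev 4 · ledger route-Parity-LambertRoots
GENERATED by the gate from the ledger (D-0016/17). Provers cite these decls: `theorem foo : Summit.Parity.BatemanHorn.Theses.LambertRoots.<Decl> := …` in Summits/Parity/BatemanHorn/Theorems/<Name>.lean.
-/

namespace Summit.Parity.BatemanHorn.Theses.LambertRoots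

open scoped BigOperators Topology Manifold Classical MeasureTheory ProbabilityTheory Matrix InnerProductSpace ComplexConjugate ContinuousMap
open Filter Set Function TopologicalSpace MeasureTheory

attribute [summit_statement] _root_.BatemanHorn

/-- item stmt-Parity-16277 · crux · rank 2 · open · by planner
why it might fail: Parity-hard: contains the smooth log-weighted polynomial Möbius atom (open in every degree ≥ 2, cf. stmt-Parity-0871/0872) and, for deg ≥ 3, balanced factorisations d,e > x with no Type-I/II structure (FordMaynard2024PrimeSieves §2.4 thin sets).
sources: HindryRivoal2005Golomb, BombieriAsymptoticSieve1976, FordMaynard2024PrimeSieves, Chowla1965, arXiv:2008.09905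
[crux] for every Bateman–Horn system f and every η > 0: Σ_(n ≤ x²) e^(−n/x) Σ_(d_i ∣ f_i(n), lcm(d)
> x^(1+η)) ∏_i μ(d_i) log d_i = o(x). k = 1, deg g: lcm = d > x^(1+η) iff the cofactor e = f(n)/d <
f(n)/x^(1+η) ≈ x^(g−1−η): Möbius randomness of the large cofactor along the root classes of f mod e
at level power-below x^(g−1) — the parity atom of the line (for n²+1: e ≤ x^(1−η); contains Σ
e^(−n/x) μ(f(n)) log f(n) = o(x)). [difficulty: open-problem] -/
@[route_item "route-Parity-LambertRoots", crux]
def DeepTail : Prop :=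
  ∀ (k : ℕ) (f : Fin k → Polynomial ℤ), Literature.NumberTheory.Sieve.IsBatemanHornSystem f → ∀ η : ℝ, 0 < η → (fun x : ℕ => ∑ n ∈ Finset.Icc 1 (x ^ 2), Real.exp (-((n : ℝ) / x)) * ∑ d ∈ Fintype.piFinset (fun i => (((f i).eval (n : ℤ)).toNat).divisors), if (x : ℝ) ^ (1 + η) < ((Finset.univ.lcm d : ℕ) : ℝ) then ∏ i, ((ArithmeticFunction.moebius (d i) : ℝ) * Real.log (d i)) else 0) =o[Filter.atTop] fun x : ℕ => (x : ℝ)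

/-- item stmt-Parity-16278 · crux · rank 3 · open · by planner
why it might fail: Needs μ-twisted root Weyl sums with power-uniformity in |j| ≤ (L/x)·polylog ≤ x^η: DFI/Tóth bounds are polynomial in the frequency, fine only for η < δ/c; for deg ≥ 3 even prime-moduli equidistribution with a rate is open (KowalskiSoundararajan2021 Conj. A.2).
sources: DukeFriedlanderIwaniec1995, Toth2000, KowalskiSoundararajan2021, DukeFriedlanderIwaniec1997, Hooley1964
[crux] for every Bateman–Horn system f there are A, η > 0 with Σ_(n ≤ x²) e^(−n/x) Σ_(d_i ∣ f_i(n),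
x(log x)^A < lcm(d) ≤ x^(1+η)) ∏_i μ(d_i) log d_i = o(x). After exchanging sums: Σ over tuples with
lcm L ∈ (x(log x)^A, x^(1+η)] of ∏μ(d_i)log d_i · Σ_(ν root class mod L) e^(−ν/x) — a ∏μ·log-signed
SMOOTH small-root statistic (kernel e^(−(ν/L)(L/x)), relative scale x/L ≥ x^(−η)) over moduli just
beyond x; no archimedean phase, no marked primes. [deps: MuRootWeyl] [difficulty: L] -/
@[route_item "route-Parity-LambertRoots", crux]
def NearWindow : Prop :=
  ∀ (k : ℕ) (f : Fin k → Polynomial ℤ), Literature.NumberTheory.Sieve.IsBatemanHornSystem f → ∃ A η : ℝ, 0 < A ∧ 0 < η ∧ (fun x : ℕ => ∑ n ∈ Finset.Icc 1 (x ^ 2), Real.exp (-((n : ℝ) / x)) * ∑ d ∈ Fintype.piFinset (fun i => (((f i).eval (n : ℤ)).toNat).divisors), if (x : ℝ) * Real.log x ^ A < ((Finset.univ.lcm d : ℕ) : ℝ) ∧ ((Finset.univ.lcm d : ℕ) : ℝ) ≤ (x : ℝ) ^ (1 + η) then ∏ i, ((ArithmeticFunction.moebius (d i) : ℝ) * Real.log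 (d i)) else 0) =o[Filter.atTop] fun x : ℕ => (x : ℝ)

/-- item stmt-Parity-16279 · crux · rank 4 · open · by planner
why it might fail: In print only the Λ-weighted prime-moduli sums for ONE quadratic (DFI 1995 negative, Tóth 2000 positive discriminant) and Hooley's untwisted (log D)^(−δ) for deg ≥ 3; k ≥ 2 needs μ⊗μ against Kloosterman-fraction CRT phases (DFI 1997 bilinear ranges + Siegel–Walfisz) — unproved as stated.
sources: DukeFriedlanderIwaniec1995, Toth2000, Hooley1964, DukeFriedlanderIwaniec1997, KowalskiSoundararajan2021
[crux] for every Bateman–Horn system f and all A, B > 0 there are C, D₀ such that for D ≥ D₀ and 0 <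
|j| ≤ (log D)^B: |Σ_(tuples d ∈ [1,D]^k, L = lcm(d) ≤ D) ∏_i μ(d_i) log d_i · Σ_(0 ≤ ν < L, d_i ∣
f_i(ν) ∀i) e(jν/L)| ≤ C·D/(log D)^A. (∏μ·log-twisted Weyl sums of the joint roots, log-power saving,
log-power frequency range; for k = 1 the inner sum is Literature.NumberTheory.Sieve.polyRootWeylSum
(f 0) L j. It does NOT assert equidistribution — false for linear f_i — only Möbius cancellation in
the modulus.) [difficulty: L] -/
@[route_item "route-Parity-LambertRoots", crux]
def MuRootWeyl : Prop :=
  ∀ (k : ℕ) (f : Fin k → Polynomial ℤ), Literature.NumberTheory.Sieve.IsBatemanHornSystem f → ∀ A B : ℝ, 0 < A → 0 < B → ∃ C : ℝ, ∃ D₀ : ℕ, ∀ D : ℕ, D₀ ≤ D → ∀ j : ℤ, j ≠ 0 → (|j| : ℝ) ≤ Real.log D ^ B → ‖∑ d ∈ (Fintype.piFinset fun _ : Fin k => Finset.Icc 1 D).filter (fun d => Finset.univ.lcm d ≤ D), ((∏ i, ((ArithmeticFunction.moebius (d i) : ℝ) * Real.log (d i)) : ℝ) : ℂ) * ∑ ν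 ∈ (Finset.range (Finset.univ.lcm d)).filter (fun ν : ℕ => ∀ i, ((d i : ℕ) : ℤ) ∣ (f i).eval (ν : ℤ)), Complex.exp (2 * Real.pi * Complex.I * ((j : ℂ) * (ν : ℂ) / ((Finset.univ.lcm d : ℕ) : ℂ)))‖ ≤ C * (D : ℝ) / Real.log D ^ A

/-- item stmt-Parity-16330 · crux · rank 5 · open · by planner
why it might fail: Theorem-grade analysis (exact geometric series + window Fourier truncation + singular series + Hardy–Littlewood–Karamata + Λ→count) but unproved and L-sized: a bookkeeping slip (sign (−1)^k, lcm vs ∏d_i, truncation n ≤ x², endpoint classes ν < n₀, kernel normalisation) would falsify it as typed.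
sources: HindryRivoal2005Golomb, Conrad2003HardyLittlewoodConstants, MontgomeryVaughan2007, Pontes2012GolombBatemanHorn
[crux] FRAME-TO-BH (the Lambert frame with its theorem-grade glue absorbed, crux-only shape for
closes): for every Bateman–Horn system f, DeepTail_f ∧ NearWindow_f ∧ MuRootWeyl_f (the three crux
conclusions for this f) imply BatemanHornAsymptotic f. Content = exact geometric series over joint
root classes (Hindry–Rivoal (14)), window via the mean-one kernel h_T and MuRootWeyl, lcm-ordered
singular series → (−1)^k C(f) (support SingularSeriesLcm), Hardy–Littlewood–Karamata un-smoothing by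
positivity (support TauberStep; tree HardyLittlewoodTauberianSums_holds) and Λ→count (support
LambdaToCount = stmt-Parity-0874 verbatim, proved). Composition from the supports + the dropped
LambertFrame is PROVED in SketchFrame2.lean (frameToBH_of_supports). Why it might fail: only through
a bookkeeping slip of mine (sign (−1)^k, lcm vs ∏d_i, truncation n ≤ x², endpoint classes ν < n₀,
kernel normalisation) — theorem-grade analysis, no arithmetic conjecture inside; sources:
HindryRivoal2005Golomb (14)/(17), Conrad2003HardyLittlewoodConstants Thm 7, MontgomeryVaughan2007
Thm 5.7, Pontes2012GolombBatemanHorn Ch. 5–6. -/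
@[route_item "route-Parity-LambertRoots", crux]
def FrameToBH : Prop :=
  ∀ (k : ℕ) (f : Fin k → Polynomial ℤ), Literature.NumberTheory.Sieve.IsBatemanHornSystem f → (∀ η : ℝ, 0 < η → (fun x : ℕ => ∑ n ∈ Finset.Icc 1 (x ^ 2), Real.exp (-((n : ℝ) / x)) * ∑ d ∈ Fintype.piFinset (fun i => (((f i).eval (n : ℤ)).toNat).divisors), if (x : ℝ) ^ (1 + η) < ((Finset.univ.lcm d : ℕ) : ℝ) then ∏ i, ((ArithmeticFunction.moebius (d i) : ℝ) * Real.log (d i)) else 0) =o[Filter.atTop] fun x : ℕ => (x : ℝ)) → (∃ A η : ℝ, 0 < A ∧ 0 < η ∧ (fun x : ℕ => ∑ n ∈ Finset.Icc 1 (x ^ 2), Real.exp (-((n : ℝ) / x)) * ∑ d ∈ Fintype.piFinset (fun i => (((f i).eval (n : ℤ)).toNat).divisors), if (x : ℝ) * Real.log x ^ A < ((Finset.univ.lcm d : ℕ) : ℝ) ∧ ((Finset.univ.lcm d : ℕ) : ℝ) ≤ (x : ℝ) ^ (1 + η) then ∏ i, ((ArithmeticFunction.moebius (d i) : ℝ)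 * Real.log (d i)) else 0) =o[Filter.atTop] fun x : ℕ => (x : ℝ)) → (∀ A B : ℝ, 0 < A → 0 < B → ∃ C₁ : ℝ, ∃ D₀ : ℕ, ∀ D : ℕ, D₀ ≤ D → ∀ j : ℤ, j ≠ 0 → (|j| : ℝ) ≤ Real.log D ^ B → ‖∑ d ∈ (Fintype.piFinset fun _ : Fin k => Finset.Icc 1 D).filter (fun d => Finset.univ.lcm d ≤ D), ((∏ i, ((ArithmeticFunction.moebius (d i) : ℝ) * Real.log (d i)) : ℝ) : ℂ) * ∑ ν ∈ (Finset.range (Finset.univ.lcm d)).filter (fun ν : ℕ => ∀ i, ((d i : ℕ) : ℤ) ∣ (f i).eval (ν : ℤ)), Complex.exp (2 * Real.pi * Complex.I * ((j : ℂ) * (ν : ℂ) / ((Finset.univ.lcm d : ℕ) : ℂ)))‖ ≤ C₁ * (D : ℝ) / Real.log D ^ A) → Literature.NumberTheory.Sieve.BatemanHornAsymptotic f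

/-- item stmt-Parity-16280 · support · rank 9 · open · by planner
sources: Conrad2003HardyLittlewoodConstants, BatemanHornMathComp1962, Pontes2012GolombBatemanHorn
[support] for every Bateman–Horn system f there is C > 0 with HasBatemanHornConst f C and Σ_(tuples
d, lcm(d) ≤ y) ∏μ(d_i)log d_i · ρ_f(d)/lcm(d) → (−1)^k C as y → ∞ (ρ_f(d) = number of joint root
classes mod lcm). The Dirichlet/power-series singular series of Golomb–Conrad
(Conrad2003HardyLittlewoodConstants Thm 7, product-polynomial form; Pontes Ch. 6 S(f) = C(f));
sibling of PolynomialMobius.TypeIMainTerm (stmt-Parity-0873) without the counting. Prime ideal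
theorem with error in the splitting fields; theorem-grade, L. [difficulty: L] -/
@[route_item "route-Parity-LambertRoots"]
def SingularSeriesLcm : Prop :=
  ∀ (k : ℕ) (f : Fin k → Polynomial ℤ), Literature.NumberTheory.Sieve.IsBatemanHornSystem f → ∃ C : ℝ, 0 < C ∧ Literature.NumberTheory.Sieve.HasBatemanHornConst f C ∧ Filter.Tendsto (fun y : ℕ => ∑ d ∈ (Fintype.piFinset fun _ : Fin k => Finset.Icc 1 y).filter (fun d => Finset.univ.lcm d ≤ y), (∏ i, ((ArithmeticFunction.moebius (d i) : ℝ) * Real.log (d i))) * ((((Finset.range (Finset.univ.lcm d)).filter (fun ν : ℕ => ∀ i, ((d i : ℕ) : ℤ) ∣ (f i).eval (ν : ℤ))).card : ℝ) / ((Finset.univ.lcm d : ℕ) : ℝ))) Filter.atTop (nhds ((-1 : ℝ) ^ k * C))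

/-- item stmt-Parity-16282 · support · rank 9 · open · by planner
sources: MontgomeryVaughan2007, HindryRivoal2005Golomb
[support] positivity un-smooths: for a Bateman–Horn system f and C > 0, Σ_(n ≤ x²) e^(−n/x)
∏Λ(f_i(n)) / x → C (x : ℕ → ∞) implies Σ_(n ≤ x) ∏Λ(f_i(n)) ~ C x. Monotone interpolation in the
smoothing parameter (integer x suffices since t ↦ Σ a_n e^(−nt) is monotone), truncation n > x²
negligible (∏Λ(f_i(n)) ≤ ∏ log f_i(n)), then the tree theorem
Literature.NumberTheory.LFunctions.HardyLittlewoodTauberianSums_holds (MV Thm 5.7, λ_n = n, β = 1,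
c_n = a_n − C, w_n = C). Provable now, M. [difficulty: provable-now] -/
@[route_item "route-Parity-LambertRoots"]
def TauberStep : Prop :=
  ∀ (k : ℕ) (f : Fin k → Polynomial ℤ), Literature.NumberTheory.Sieve.IsBatemanHornSystem f → ∀ C : ℝ, 0 < C → Filter.Tendsto (fun x : ℕ => (∑ n ∈ Finset.Icc 1 (x ^ 2), Real.exp (-((n : ℝ) / x)) * ∏ i, ArithmeticFunction.vonMangoldt (((f i).eval (n : ℤ)).toNat)) / (x : ℝ)) Filter.atTop (nhds C) → Asymptotics.IsEquivalent Filter.atTop (fun x : ℕ => ∑ n ∈ Finset.Icc 1 x, ∏ i, ArithmeticFunction.vonMangoldt (((f i).eval (n : ℤ)).toNat)) (fun x : ℕ => C * (x : ℝ))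

/-- item stmt-Parity-16283 · support · rank 9 · open · by planner
sources: BatemanHornMathComp1962
[support] shared VERBATIM with PolynomialMobius (stmt-Parity-0874, closed proved by
Summit.Parity.BatemanHorn.LambdaToCount.lambdaToCount_proof): Σ_(n ≤ x) ∏Λ(f_i(n)) ~ C x with
HasBatemanHornConst f C gives BatemanHornAsymptotic f. [difficulty: provable-now] -/
@[route_item "route-Parity-LambertRoots"]
def LambdaToCount : Prop :=
  ∀ (k : ℕ) (f : Fin k → Polynomial ℤ), Literature.NumberTheory.Sieve.IsBatemanHornSystem f → ∀ C : ℝ, 0 < C → Literature.NumberTheory.Sieve.HasBatemanHornConst f C → Asymptotics.IsEquivalent Filter.atTop (fun x : ℕ => ∑ n ∈ Finset.Icc 1 x, ∏ i, ArithmeticFunction.vonMangoldt (((f i).eval (n : ℤ)).toNat)) (fun x : ℕ => C * (x : ℝ)) → Literature.NumberTheory.Sieve.BatemanHornAsymptotic f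

-- earlier Assembly (stmt-Parity-16284, replaced 2026-08-16T16:38:06Z -> stmt-Parity-15690): retired by None — DeepTail → NearWindow → MuRootWeyl → SingularSeriesLcm → LambertFrame → TauberStep → LambdaToCount → _root_.BatemanHorn
/-- item stmt-Parity-15690 · assembly · rank 1 · open · by planner
sources: HindryRivoal2005Golomb, MontgomeryVaughan2007
[assembly] DeepTail → NearWindow → MuRootWeyl → FrameToBH → BatemanHorn (the crux-only shape of
`closes`; FrameToBH ⇐ SingularSeriesLcm + TauberStep + LambdaToCount + the Lambert-series
bookkeeping, composition proved in the planner folder SketchFrame2.lean). -/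
@[route_item "route-Parity-LambertRoots"]
def Assembly : Prop :=
  DeepTail → NearWindow → MuRootWeyl → FrameToBH → _root_.BatemanHorn

/-! D-0027 §2.1 — DECIDING THEOREM (planner-authored via `route open/edit --closes-file`; by planner-plan-lens-Parity-rescuer-v2-g2-0 2026-08-16T16:36:57Z):
its hypotheses are this route's items and its conclusion the sub-problem Statement (glue_lint), and it elaborates with this file. -/

/-- D-0027 §2.1 deciding theorem of route LambertRoots (crux-only shape): the cruxes `DeepTail` (r2), `NearWindow` (r3),
`MuRootWeyl` (r4) and the frame crux `FrameToBH` (r5: for each system, the three crux conclusions imply the Bateman–Horn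
asymptotic — the Lambert-series bookkeeping + singular series + Hardy–Littlewood–Karamata + Λ-to-count, whose pieces are the
support items `SingularSeriesLcm`, `TauberStep`, `LambdaToCount` and the dropped `LambertFrame`) imply the sub-problem statement
`BatemanHorn` (= `Literature.NumberTheory.Sieve.BatemanHornConjecture`). Pure logic. -/
@[closes "route-Parity-LambertRoots"] theorem closes (hDeep : DeepTail) (hNear : NearWindow) (hWeyl : MuRootWeyl) (hFrame : FrameToBH) :
    _root_.BatemanHorn := fun k f hf =>
  hFrame k f hf (hDeep k f hf) (hNear k f hf) (hWeyl k f hf)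

end Summit.Parity.BatemanHorn.Theses.LambertRoots
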